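import Summits.QuantumFields.Balaban3D.Carriers.RT

/-!
# Lane `pub-balaban3d` — carrier layer p1 (`Carriers.RTSelect`): version selection of the renormalization transform (lead ruling R-RN)

The RN derivative of `Carriers.RT` is an a.e.-CLASS; LQB's (5)/(41)/(55) are POINTWISE.  Ruling R-RN (lane STATUS 2026-08-22T00:13:47Z):
the construction's `T` is «RN transport, then re-selection of the version inside the step sandwich `lower ≤ · ≤ upper`».  [folklore]
measure theory; nothing of CMP 102 is asserted.
-/

open MeasureTheory

namespace Summit.QuantumFields.Balaban3D.Carriers

open Literature.MathematicalPhysics.QuantumFieldTheory.Balaban1983to89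
open Literature.MathematicalPhysics.QuantumFieldTheory.Balaban1983to89.AveragingRT

/-! ## §6 Version selection (lead ruling R-RN): the RN transport re-selected inside a measurable sandwich

The RN derivative is an a.e.-CLASS; LQB's (5)/(41)/(55) are POINTWISE.  Ruling R-RN (lane STATUS 2026-08-22T00:13:47Z): the
construction's `T` is «RN transport, then re-selection of the version inside the step sandwich `lower ≤ · ≤ upper`», in the ONE-SIDED
two-flag form of ruling R-SEL (a) (lane STATUS 2026-08-22T01:42:45Z): the upper half is corrected whenever the RN version lies below
`upper` dV-a.e., the lower half whenever it lies above `lower` dV-a.e., independently (LQB's `Bound55` sees only (41)_k, `Bound55Lower`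
only (47)_k); each correction changes a null set, so the selected version is a.e. the RN version and still a renormalization transform of
the same density (`IsRT` only sees the a.e.-class).  No bound is «selected into existence»: the honesty corollary is `selectVersion_ae_eq`. -/

section Select

variable {P : Params} {j : ℕ} {G : Type*} [GaugeGroup G] [MeasurableSpace G] [HaarData G]

open Classical in
/-- UPPER CORRECTION (ruling R-SEL (a): one-sided, independent of the lower barrier): if the candidate lies below `upper` dV-a.e.,
clip it to `upper` everywhere (a change on a null set); otherwise leave it. [folklore] -/
noncomputable def clipUpper (upper ρ' : Density P j G) : Density P j G :=
  if (∀ᵐ V ∂(fieldMeasure P j G), ρ' V ≤ upper V) then fun V => min (ρ' V) (upper V) else ρ'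

open Classical in
/-- LOWER CORRECTION (ruling R-SEL (a)): if the candidate lies above `lower` dV-a.e., raise it to `lower` everywhere (a change on a
null set); otherwise leave it. [folklore] -/
noncomputable def clipLower (lower ρ' : Density P j G) : Density P j G :=
  if (∀ᵐ V ∂(fieldMeasure P j G), lower V ≤ ρ' V) then fun V => max (ρ' V) (lower V) else ρ'

/-- VERSION SELECTION (ruling R-RN, two-flag form of R-SEL (a)): the candidate corrected first at the upper, then at the lower barrier —
each half fires on its own a.e. hypothesis (leaf locality: LQB's `Bound55` has only (41)_k in scope, `Bound55Lower` only (47)_k). [folklore] -/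
noncomputable def selectVersion (lower upper ρ' : Density P j G) : Density P j G :=
  clipLower lower (clipUpper upper ρ')

/-- The upper correction is a.e. the identity. [folklore] -/
theorem clipUpper_ae_eq (upper ρ' : Density P j G) : clipUpper upper ρ' =ᵐ[fieldMeasure P j G] ρ' := by
  unfold clipUpper
  by_cases h : ∀ᵐ V ∂(fieldMeasure P j G), ρ' V ≤ upper V
  · rw [if_pos h]
    filter_upwards [h] with V hV
    exact min_eq_left hV
  · rw [if_neg h]

/-- The lower correction is a.e. the identity. [folklore] -/
theorem clipLower_ae_eq (lower ρ' : Density P j G) : clipLower lower ρ' =ᵐ[fieldMeasure P j G] ρ' := by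
  unfold clipLower
  by_cases h : ∀ᵐ V ∂(fieldMeasure P j G), lower V ≤ ρ' V
  · rw [if_pos h]
    filter_upwards [h] with V hV
    exact max_eq_left hV
  · rw [if_neg h]

/-- The selected version is a.e. equal to the candidate (HONESTY of R-RN: no bound is «selected into existence»). [folklore] -/
theorem selectVersion_ae_eq (lower upper ρ' : Density P j G) :
    selectVersion lower upper ρ' =ᵐ[fieldMeasure P j G] ρ' :=
  (clipLower_ae_eq lower _).trans (clipUpper_ae_eq upper ρ')

/-- If the candidate lies below `upper` a.e., the upper-corrected version lies below it EVERYWHERE. [folklore] -/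
theorem clipUpper_le {upper ρ' : Density P j G} (hae : ∀ᵐ V ∂(fieldMeasure P j G), ρ' V ≤ upper V) (V : GaugeField P j G) :
    clipUpper upper ρ' V ≤ upper V := by
  unfold clipUpper; rw [if_pos hae]; exact min_le_right _ _

/-- If the candidate lies above `lower` a.e., the lower-corrected version lies above it EVERYWHERE. [folklore] -/
theorem le_clipLower {lower ρ' : Density P j G} (hae : ∀ᵐ V ∂(fieldMeasure P j G), lower V ≤ ρ' V) (V : GaugeField P j G) :
    lower V ≤ clipLower lower ρ' V := by
  unfold clipLower; rw [if_pos hae]; exact le_max_right _ _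

/-- The lower correction never decreases the candidate. [folklore] -/
theorem le_clipLower_self (lower ρ' : Density P j G) (V : GaugeField P j G) : ρ' V ≤ clipLower lower ρ' V := by
  unfold clipLower; split_ifs
  · exact le_max_left _ _
  · exact le_rfl

/-- The lower correction stays below any pointwise bound of the candidate that dominates `lower`. [folklore] -/
theorem clipLower_le {lower upper ρ' : Density P j G} (hlu : ∀ V, lower V ≤ upper V) (hρ : ∀ V, ρ' V ≤ upper V)
    (V : GaugeField P j G) : clipLower lower ρ' V ≤ upper V := by
  unfold clipLower; split_ifs
  · exact max_le (hρ V) (hlu V)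
  · exact hρ V

/-- **ONE-SIDED SELECTION PROPERTY, upper half** (rulings R-RN «select_spec» / R-SEL (a)): if the candidate lies below `upper` dV-a.e. and `lower ≤ upper` pointwise, the
selected version lies below `upper` EVERYWHERE — no hypothesis on the lower a.e. bound. [folklore] -/
theorem selectVersion_le_upper {lower upper ρ' : Density P j G} (hlu : ∀ V, lower V ≤ upper V)
    (hae : ∀ᵐ V ∂(fieldMeasure P j G), ρ' V ≤ upper V) (V : GaugeField P j G) :
    selectVersion lower upper ρ' V ≤ upper V :=
  clipLower_le hlu (clipUpper_le hae) V

/-- **ONE-SIDED SELECTION PROPERTY, lower half** (rulings R-RN «select_spec» / R-SEL (a)): if the candidate lies above `lower` dV-a.e., the selected version lies above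
`lower` EVERYWHERE — no hypothesis on the upper barrier at all. [folklore] -/
theorem lower_le_selectVersion {lower upper ρ' : Density P j G}
    (hae : ∀ᵐ V ∂(fieldMeasure P j G), lower V ≤ ρ' V) (V : GaugeField P j G) :
    lower V ≤ selectVersion lower upper ρ' V := by
  refine le_clipLower ?_ V
  filter_upwards [hae, clipUpper_ae_eq upper ρ'] with W h1 h2
  rw [h2]; exact h1

/-- Two-sided form (the sandwich EVERYWHERE from both a.e. bounds and `lower ≤ upper`). [folklore] -/
theorem selectVersion_bounds {lower upper ρ' : Density P j G} (hlu : ∀ V, lower V ≤ upper V)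
    (hae : ∀ᵐ V ∂(fieldMeasure P j G), lower V ≤ ρ' V ∧ ρ' V ≤ upper V) (V : GaugeField P j G) :
    lower V ≤ selectVersion lower upper ρ' V ∧ selectVersion lower upper ρ' V ≤ upper V :=
  ⟨lower_le_selectVersion (hae.mono fun _ h => h.1) V, selectVersion_le_upper hlu (hae.mono fun _ h => h.2) V⟩

/-- The selected version of a non-negative candidate with non-negative barriers is non-negative everywhere. [folklore] -/
theorem selectVersion_nonneg {lower upper ρ' : Density P j G} (hρ' : ∀ V, 0 ≤ ρ' V)
    (hu : ∀ V, 0 ≤ upper V) (V : GaugeField P j G) : 0 ≤ selectVersion lower upper ρ' V := by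
  refine le_trans ?_ (le_clipLower_self lower _ V)
  unfold clipUpper; split_ifs
  · exact le_min (hρ' V) (hu V)
  · exact hρ' V

/-- The selected version is measurable when the barriers and the candidate are. [folklore] -/
theorem measurable_selectVersion {lower upper ρ' : Density P j G} (hl : Measurable lower) (hu : Measurable upper)
    (hρ' : Measurable ρ') : Measurable (selectVersion lower upper ρ') := by
  have h1 : Measurable (clipUpper upper ρ') := by
    unfold clipUpper; split_ifs
    · exact hρ'.min hu
    · exact hρ'
  unfold selectVersion clipLower; split_ifs
  · exact h1.max hl
  · exact h1

/-- `IsRT` only sees the a.e.-class of the transform. [folklore] -/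
theorem isRT_congr_ae {avg : GaugeField P j G → GaugeField P (j+1) G} {ρ : Density P j G} {ρ₁ ρ₂ : Density P (j+1) G}
    (h : IsRT avg ρ ρ₁) (h12 : ρ₁ =ᵐ[fieldMeasure P (j+1) G] ρ₂) : IsRT avg ρ ρ₂ := by
  intro f hf hfC
  rw [← h f hf hfC]
  refine integral_congr_ae ?_
  filter_upwards [h12] with V hV
  rw [hV]

/-- THE CONSTRUCTION'S RENORMALIZATION TRANSFORMATION (rulings R-D1 + R-RN + R-SEL): RN transport under `AvgAC`, re-selected inside the
step sandwich `lower ≤ · ≤ upper` by the two one-sided corrections (barriers = the printed lower/upper step bounds (57)/(55), DEFINED by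
`Carriers.Series`; `upper ≥ 0` keeps the selected version non-negative).  ⟦reading R-RN: version selection; all versions agree dV-a.e.⟧ [cite: Balaban1985Averaging, (10) p.19] -/
noncomputable def rtOpISelect (av : Averaging P j G) (h : AvgAC av.avg) (lower upper : Density P (j+1) G)
    (hu : ∀ V, 0 ≤ upper V) : RTOpI P j G av where
  T := fun ρ => selectVersion lower upper (rnTransport av.avg ρ)
  isRT := fun ρ hρ => isRT_congr_ae (isRT_rnTransport_of_ac h ρ hρ) (selectVersion_ae_eq _ _ _).symm
  pos := fun ρ h0 V => selectVersion_nonneg (rnTransport_nonneg av.avg ρ h0) hu V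

/-- Unfolding lemma for `rtOpISelect`. [folklore] -/
theorem rtOpISelect_T (av : Averaging P j G) (h : AvgAC av.avg) (lower upper : Density P (j+1) G)
    (hu : ∀ V, 0 ≤ upper V) (ρ : Density P j G) :
    (rtOpISelect av h lower upper hu).T ρ = selectVersion lower upper (rnTransport av.avg ρ) := rfl

/-- HONESTY: the constructed transform of any density is a.e. EQUAL to the plain RN transport. [folklore] -/
theorem rtOpISelect_ae_eq_rn (av : Averaging P j G) (h : AvgAC av.avg) (lower upper : Density P (j+1) G)
    (hu : ∀ V, 0 ≤ upper V) (ρ : Density P j G) :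
    (rtOpISelect av h lower upper hu).T ρ =ᵐ[fieldMeasure P (j+1) G] rnTransport av.avg ρ :=
  selectVersion_ae_eq _ _ _

/-- The constructed transform preserves integrability. [folklore] -/
theorem integrable_rtOpISelect (av : Averaging P j G) (h : AvgAC av.avg) (lower upper : Density P (j+1) G)
    (hu : ∀ V, 0 ≤ upper V) (ρ : Density P j G) (hρ : Integrable ρ (fieldMeasure P j G)) :
    Integrable ((rtOpISelect av h lower upper hu).T ρ) (fieldMeasure P (j+1) G) :=
  (integrable_rnTransport av.avg ρ hρ).congr (selectVersion_ae_eq _ _ _).symm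

/-- The constructed transform of any density is measurable when the barriers are. [folklore] -/
theorem measurable_rtOpISelect (av : Averaging P j G) (h : AvgAC av.avg) {lower upper : Density P (j+1) G}
    (hu : ∀ V, 0 ≤ upper V) (hlm : Measurable lower) (hum : Measurable upper) (ρ : Density P j G) :
    Measurable ((rtOpISelect av h lower upper hu).T ρ) :=
  measurable_selectVersion hlm hum (measurable_rnTransport _ _)

/-- The constructed transform preserves the integral of integrable densities ((6) step). [cite: Balaban1985UV3, (6) p.257] -/
theorem integral_rtOpISelect (av : Averaging P j G) (h : AvgAC av.avg) (lower upper : Density P (j+1) G)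
    (hu : ∀ V, 0 ≤ upper V) (ρ : Density P j G) (hρ : Integrable ρ (fieldMeasure P j G)) :
    ∫ V, (rtOpISelect av h lower upper hu).T ρ V ∂(fieldMeasure P (j+1) G) = ∫ U, ρ U ∂(fieldMeasure P j G) :=
  integral_eq_of_isRT ((rtOpISelect av h lower upper hu).isRT ρ hρ)

/-- ONE-SIDED selection property, upper half (rulings R-RN «select_spec» / R-SEL (a)): the RN transport below `upper` a.e. and `lower ≤ upper` ⇒ the constructed transform
is below `upper` POINTWISE. [folklore] -/
theorem rtOpISelect_le_upper (av : Averaging P j G) (h : AvgAC av.avg) {lower upper : Density P (j+1) G}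
    (hu : ∀ V, 0 ≤ upper V) (hlu : ∀ V, lower V ≤ upper V) (ρ : Density P j G)
    (hae : ∀ᵐ V ∂(fieldMeasure P (j+1) G), rnTransport av.avg ρ V ≤ upper V) (V : GaugeField P (j+1) G) :
    (rtOpISelect av h lower upper hu).T ρ V ≤ upper V :=
  selectVersion_le_upper hlu hae V

/-- ONE-SIDED selection property, lower half (rulings R-RN «select_spec» / R-SEL (a)): the RN transport above `lower` a.e. ⇒ the constructed transform is above `lower`
POINTWISE. [folklore] -/
theorem rtOpISelect_lower_le (av : Averaging P j G) (h : AvgAC av.avg) {lower upper : Density P (j+1) G}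
    (hu : ∀ V, 0 ≤ upper V) (ρ : Density P j G)
    (hae : ∀ᵐ V ∂(fieldMeasure P (j+1) G), lower V ≤ rnTransport av.avg ρ V) (V : GaugeField P (j+1) G) :
    lower V ≤ (rtOpISelect av h lower upper hu).T ρ V :=
  lower_le_selectVersion hae V

/-- Two-sided selection property (ruling R-RN's «select_spec»): if the RN transport of `ρ` satisfies the sandwich dV-a.e. and `lower ≤ upper`, the constructed
transform satisfies it POINTWISE. [folklore] -/
theorem rtOpISelect_sandwich (av : Averaging P j G) (h : AvgAC av.avg) {lower upper : Density P (j+1) G}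
    (hu : ∀ V, 0 ≤ upper V) (hlu : ∀ V, lower V ≤ upper V) (ρ : Density P j G)
    (hae : ∀ᵐ V ∂(fieldMeasure P (j+1) G), lower V ≤ rnTransport av.avg ρ V ∧ rnTransport av.avg ρ V ≤ upper V)
    (V : GaugeField P (j+1) G) :
    lower V ≤ (rtOpISelect av h lower upper hu).T ρ V ∧ (rtOpISelect av h lower upper hu).T ρ V ≤ upper V :=
  selectVersion_bounds hlu hae V

end Select

end Summit.QuantumFields.Balaban3D.Carriers
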